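/-
Copyright: statement-level skeleton of a published paper (lit-balaban cell, Phase-2 proof seat p13, gen 11; v1.1: §5 appended,
every v1 declaration (p313665) byte-identical). No proof claims beyond what the kernel checks below.
-/
import Literature.MathematicalPhysics.QuantumFieldTheory.BalabanImbrieJaffe1984to88.BIJ88Sect5StatementsPart4

/-!
# `BalabanImbrieJaffe1984to88.BIJ88Resummation5710` — T. Bałaban, J. Imbrie, A. Jaffe, *Effective action and cluster
properties of the abelian Higgs model*, Commun. Math. Phys. **114** (1988) 257–315 [BalabanImbrieJaffe1988]: Sect. 5.7,
p. 292 — THE RESUMMATION OF THE LOW-ORDER TERMS BY THE MINIMAL SCALE: display **(5.7.10)** PROVED as a finite identity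
(multilinear expansion of `(Σ_l ∂/∂e′_l)ⁿ` and regrouping of the tuples of scales by their minimum), the `m`-th group and
the leading terms **(5.7.12)** TYPED WITH BODY.

## The print (p. 292 [PDF 36] and p. 293 [PDF 37], verbatim)

*"The low order terms can be written as  Σ_{n=1}^{n̄} (1/n!) [Π_{α=1}^{n} (Σ_{j_α=0}^{k} d/de′_{j_α}) log Z^{(j)}_{Λ₁₀^{(j)}}(u_{k+1} exp(ie_jζ
Σ_{l=0}^{k} e′_l Ã̃_l))]_{e′_l=0}.  Note that Z^{(j)}_{Λ₁₀^{(j)}}(…) depends only on e_l for l ≥ j. Thus we can write the last expression as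
Σ_{m=j}^{k} Σ_{n=1}^{n̄} (1/n!) Σ_{{j_α}_{α=1}^{n} : min_α j_α = m} [Π_{α=1}^{n} d/de′_{j_α} log Z^{(j)}_{Λ₁₀^{(j)}}(u_{k+1} exp(ie_jζ Σ_{l=j}^{k}
e′_l Ã̃_l))]_{e′_l=0}. (5.7.10)"*  …  *"The leading terms are now  Σ_{n=1}^{n̄} (1/n!) Σ_{{j_α}: min_α j_α = m} [Π_{α=1}^{n} d/de′_{j_α}
log Z^{(j)}_{B_{m−j}(Λ₃^{(m)})}(Λ̄₂^{(m)}, u_{k+1} exp(ie_jζ Σ_{l=j}^{k} e′_l Ã̃_l))]_{e′_l=0}, (5.7.12) where this Z^{(j)} uses the quadratic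
form in (5.7.11)."*

statement-level skeleton of published theorems with citation tags; proofs where landed; nothing here is a claim about the Yang–Mills mass gap

PDF held: `paper:balaban1988-cmp114-bij-abelian-higgs-effective-action` (journal page = PDF page + 256); pp. 292–293
[PDF 36–37] read as IMAGES (CCITT renders; copies `HOME/lit-balaban-p13/pages/original-p036-x2.png`, `-p037-x2.png`).

CITATION HEADER (lean-in-tree rule).  Part of the lit-balaban TYPED SKELETON (HOME `run/shared/lean/pub/lit-balaban/`):
WHAT IS REPRODUCED = row **C2.Eq5.7.10-5.7.12** of `HOME/lit-balaban-r16/ROWS-C2-part2.md` (E-row, pp. 291–294), members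
*(5.7.10) (the display) and (5.7.12)*.  Unit `lit-balaban-p13` (gen 11), owner r16, referee ref-5.  Companion of r16's
`BIJ88Sect5StatementsPart4.telescope5710`/`eq5710_split` and `BIJ88Theta561Witness` (the FIELD split `Ã̃ = Ã̃_k + Σ_j Ã̃_j`
behind (5.7.10)); the one-parameter perturbative sums of (5.6.14)/(5.7.15) are r16's `pertP` / p02's `BIJ88PertQ5715.pertQ5715`.
Built on Mathlib's `iteratedFDeriv`, `ContinuousMultilinearMap.map_sum_finset`, `ContinuousLinearMap.iteratedFDeriv_comp_right`,
`Finset.min'`; nothing restated.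

## The typing (READING declared)

The parameters are `e′ = (e′_l)_{l ∈ L}` for a finite linearly ordered set of scales `L` (print: `{0,…,k}`), the generating function
is an INPUT `Φ : (L → ℝ) → ℝ` (print: `e′ ↦ log Z^{(j)}_{Λ₁₀^{(j)}}(u_{k+1} exp(ie_jζ Σ_l e′_l Ã̃_l))`, resp. with the (5.7.11)-form for
(5.7.12), resp. `log Z_m(…)` for the resummed p. 294 display), *"[Π_α d/de′_{j_α} Φ]_{e′=0}"* is the `n`-th Fréchet derivative at
`0` on the coordinate directions (`mixedPartial`), *"Π_α (Σ_{j_α ∈ S} d/de′_{j_α})"* at `0` is the `n`-th derivative on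
`(𝟙_S, …, 𝟙_S)`, `𝟙_S = Σ_{l∈S} e_l` (`dirPower`), the active scales `S ⊂ L` (print: `{j,…,k}`).

## What is kernel-checked here

* §1 `dirPower_eq_sum_mixedPartial` — `[(Σ_{l∈S} ∂_l)ⁿ Φ](0) = Σ_{J ∈ Sⁿ} [∂_J Φ](0)` (multilinearity).
* §2 `IsMinScale J m` (*"min_α j_α = m"*, decidable), `isMinScale_iff_min'_eq`, **`sum_piFinset_eq_sum_isMinScale`** — a sum over
  `Sⁿ` (`n ≥ 1`) regrouped by the minimal entry; `not_isMinScale_zero`.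
* §3 `lowOrder` (the first display), **`leadGroup`** (the `m`-th group of (5.7.10) = the functional of (5.7.12), definition with
  body), **`eq5710`** — (5.7.10): `lowOrder Φ n̄ S = Σ_{m∈S} leadGroup Φ n̄ S m`; `leadGroup_eq_zero_of_not_mem`.
* §4 `iteratedDeriv_comp_line` (`dⁿ/dtⁿ Φ(t·v)|₀ = DⁿΦ(0)(v,…,v)` for `Φ ∈ Cⁿ`) and **`lowOrder_eq_sum_iteratedDeriv`** — the low-order
  terms as the one-parameter Taylor sum `Σ_{n=1}^{n̄} (1/n!) dⁿ/dtⁿ Φ(t·𝟙_S)|_{t=0}` (the (5.6.14)/(5.7.15) shape).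
* §5 (v1.1) THE TOP GROUP `m = k = max S`: `isMinScale_max_iff` (a tuple from `Sⁿ` has minimal scale `max S` iff it is constant),
  **`leadGroup_max`** (`leadGroup Φ n̄ S k = Σ_{n=1}^{n̄} (1/n!) [∂ⁿ/∂e′_kⁿ Φ]_{e′=0}`), `mixedPartial_const_eq_iteratedDeriv`,
  **`leadGroup_max_eq_sum_iteratedDeriv`** — the top group is the one-parameter Taylor sum in the top-scale field alone, the shape
  of (5.7.15) `Q^{(k)} = Σ_{n=1}^{n̄} dⁿ/de′ⁿ log[…]_{e′=0}` (p. 295: *"The result is our standard perturbative expansion in the field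
  θ_kH_{k,loc}A^{(k)}, which we denote Q^{(k)}"*; r16's `pertP`, p02's `pertQ5715`).

HONEST SCOPE.  Finite algebra of the resummation only: `Φ` and its smoothness are inputs; *"depends only on e_l for l ≥ j"*
is the choice of `S`; the replacements leading from (5.7.10) to (5.7.12) (propagators, (5.7.11), no Dirichlet b.c.) and the
remainder bounds are the other members of the row (`BIJ88Delta5711`, `BIJ88DirichletReplacement292`, `BIJ88NoDirichlet294`,
`BIJ88Neumann5711`, `BIJ88SmallLetterRemainders293`, `BIJ88W2Localized292`) — here (5.7.12) is the functional `leadGroup` at the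
input function of the instance.  Definitions with bodies (`mixedPartial`, `dirPower`, `IsMinScale` + instance, `lowOrder`,
`leadGroup`) + theorems; no `Prop` facts; axioms standard.
-/

noncomputable section

open scoped BigOperators
open Finset

namespace Literature.MathematicalPhysics.QuantumFieldTheory.BalabanImbrieJaffe1984to88.BIJ88Resummation5710

variable {L : Type*} [Fintype L] [DecidableEq L] [LinearOrder L]

/-! ## §1 Mixed partial derivatives at `e′ = 0` and the multilinear expansion of `(Σ_l ∂/∂e′_l)ⁿ` -/

/-- The MIXED PARTIAL `[∂/∂e′_{j₁} ⋯ ∂/∂e′_{j_n} Φ]_{e′=0}` of a function of the parameters `e′ = (e′_l)_{l ∈ L}` (print: `Φ(e′) =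
log Z^{(j)}_{Λ₁₀^{(j)}}(u_{k+1} exp(ie_jζ Σ_l e′_l Ã̃_l))`), for a tuple of scales `J = (j₁,…,j_n)`: the `n`-th Fréchet derivative at
`0` evaluated on the coordinate directions. [cite: BalabanImbrieJaffe1988, (5.7.10) p.292] -/
def mixedPartial (Φ : (L → ℝ) → ℝ) (n : ℕ) (J : Fin n → L) : ℝ :=
  iteratedFDeriv ℝ n Φ 0 (fun α => (Pi.single (J α) (1 : ℝ) : L → ℝ))

/-- `[(Σ_{l ∈ S} ∂/∂e′_l)ⁿ Φ]_{e′=0}`: the `n`-th derivative at `0` in the direction `𝟙_S = Σ_{l∈S} e_l` (all the scales of `S`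
switched on together). [cite: BalabanImbrieJaffe1988, (5.7.10) p.292] -/
def dirPower (Φ : (L → ℝ) → ℝ) (n : ℕ) (S : Finset L) : ℝ :=
  iteratedFDeriv ℝ n Φ 0 (fun _ => ∑ l ∈ S, (Pi.single l (1 : ℝ) : L → ℝ))

omit [LinearOrder L] in
/-- **`Π_{α=1}^{n} (Σ_{j_α ∈ S} ∂/∂e′_{j_α}) = Σ_{(j₁…j_n) ∈ Sⁿ} Π_α ∂/∂e′_{j_α}`** at `e′ = 0`: multilinearity of the `n`-th derivative.
[cite: BalabanImbrieJaffe1988, (5.7.10) p.292] -/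
theorem dirPower_eq_sum_mixedPartial (Φ : (L → ℝ) → ℝ) (n : ℕ) (S : Finset L) :
    dirPower Φ n S = ∑ J ∈ Fintype.piFinset (fun _ : Fin n => S), mixedPartial Φ n J := by
  unfold dirPower mixedPartial
  exact ContinuousMultilinearMap.map_sum_finset _ (fun (_ : Fin n) (l : L) => (Pi.single l (1 : ℝ) : L → ℝ)) (fun _ => S)

/-! ## §2 Regrouping the tuples of scales by their minimum -/

/-- `m` is the MINIMAL scale of the tuple `J = (j₁,…,j_n)`: *"{j_α} : min_α j_α = m"*. [cite: BalabanImbrieJaffe1988, (5.7.10) p.292] -/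
def IsMinScale {n : ℕ} (J : Fin n → L) (m : L) : Prop := (∃ α, J α = m) ∧ ∀ α, m ≤ J α

/-- `IsMinScale` is decidable (finitely many positions), so that tuples can be filtered by their minimal scale.
[cite: BalabanImbrieJaffe1988, (5.7.10) p.292] -/
instance instDecidableIsMinScale {n : ℕ} (J : Fin n → L) (m : L) : Decidable (IsMinScale J m) := by
  unfold IsMinScale; infer_instance

omit [Fintype L] in
/-- for a non-empty tuple, `IsMinScale J m` says exactly that `m` is the minimum of the values of `J`.
[cite: BalabanImbrieJaffe1988, (5.7.10) p.292] -/
theorem isMinScale_iff_min'_eq {n : ℕ} (hn : 0 < n) (J : Fin n → L) (m : L) :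
    IsMinScale J m ↔ (Finset.univ.image J).min' ⟨J ⟨0, hn⟩, Finset.mem_image_of_mem J (Finset.mem_univ _)⟩ = m := by
  set s := Finset.univ.image J with hs
  have hne : s.Nonempty := ⟨J ⟨0, hn⟩, Finset.mem_image_of_mem J (Finset.mem_univ _)⟩
  constructor
  · rintro ⟨⟨α, hα⟩, hle⟩
    apply le_antisymm
    · rw [← hα]; exact Finset.min'_le s (J α) (Finset.mem_image_of_mem J (Finset.mem_univ α))
    · rw [Finset.le_min'_iff]
      intro y hy
      obtain ⟨β, -, rfl⟩ := Finset.mem_image.mp hy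
      exact hle β
  · intro h
    refine ⟨?_, fun α => ?_⟩
    · have hm : m ∈ s := by rw [← h]; exact Finset.min'_mem s hne
      obtain ⟨α, -, hα⟩ := Finset.mem_image.mp hm
      exact ⟨α, hα⟩
    · rw [← h]; exact Finset.min'_le s (J α) (Finset.mem_image_of_mem J (Finset.mem_univ α))

omit [Fintype L] in
/-- **REGROUPING BY THE MINIMAL SCALE**: a sum over the tuples `(j₁,…,j_n) ∈ Sⁿ` (`n ≥ 1`) is the sum over `m ∈ S` of the sums
over the tuples with `min_α j_α = m` — *"Thus we can write the last expression as Σ_{m=j}^{k} Σ_n (1/n!) Σ_{{j_α}: min_α j_α = m} …"*.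
[cite: BalabanImbrieJaffe1988, (5.7.10) p.292] -/
theorem sum_piFinset_eq_sum_isMinScale {n : ℕ} (hn : 0 < n) (S : Finset L) (f : (Fin n → L) → ℝ) :
    ∑ J ∈ Fintype.piFinset (fun _ : Fin n => S), f J =
      ∑ m ∈ S, ∑ J ∈ (Fintype.piFinset (fun _ : Fin n => S)).filter (fun J => IsMinScale J m), f J := by
  set P := Fintype.piFinset (fun _ : Fin n => S) with hP
  -- the minimum map lands in S
  set g : (Fin n → L) → L := fun J =>
    (Finset.univ.image J).min' ⟨J ⟨0, hn⟩, Finset.mem_image_of_mem J (Finset.mem_univ _)⟩ with hg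
  have hmaps : ∀ J ∈ P, g J ∈ S := by
    intro J hJ
    have hmem : g J ∈ Finset.univ.image J := Finset.min'_mem _ _
    obtain ⟨α, -, hα⟩ := Finset.mem_image.mp hmem
    rw [← hα]
    exact Fintype.mem_piFinset.mp hJ α
  rw [← Finset.sum_fiberwise_of_maps_to hmaps]
  refine Finset.sum_congr rfl fun m _ => Finset.sum_congr ?_ fun _ _ => rfl
  ext J
  simp only [Finset.mem_filter]
  rw [isMinScale_iff_min'_eq hn]

omit [Fintype L] [DecidableEq L] in
/-- no tuple of length `0` has a minimal scale. [cite: BalabanImbrieJaffe1988, (5.7.10) p.292] -/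
theorem not_isMinScale_zero (J : Fin 0 → L) (m : L) : ¬ IsMinScale J m := fun ⟨⟨α, _⟩, _⟩ => α.elim0

/-! ## §3 The low-order terms, (5.7.10) and (5.7.12) -/

/-- THE LOW-ORDER TERMS BEFORE RESUMMATION (p. 292, first display): *"Σ_{n=1}^{n̄} (1/n!) [Π_{α=1}^{n} (Σ_{j_α=0}^{k} ∂/∂e′_{j_α})
log Z^{(j)}_{Λ₁₀^{(j)}}(u_{k+1} exp(ie_jζ Σ_{l=0}^{k} e′_l Ã̃_l))]_{e′_l=0}"* — for the scales `S` (print: `{0,…,k}`, effectively `{j,…,k}`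
since *"Z^{(j)}_{Λ₁₀^{(j)}}(…) depends only on e_l for l ≥ j"*) and `Φ(e′) = log Z^{(j)}(…)`. [cite: BalabanImbrieJaffe1988, (5.7.10) p.292] -/
def lowOrder (Φ : (L → ℝ) → ℝ) (nbar : ℕ) (S : Finset L) : ℝ :=
  ∑ n ∈ Finset.Icc 1 nbar, (1 / (n.factorial : ℝ)) * dirPower Φ n S

/-- **THE `m`-TH GROUP OF (5.7.10)** (verbatim): *"Σ_{n=1}^{n̄} (1/n!) Σ_{{j_α}_{α=1}^{n} : min_α j_α = m} [Π_{α=1}^{n} ∂/∂e′_{j_α}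
log Z^{(j)}_{Λ₁₀^{(j)}}(u_{k+1} exp(ie_jζ Σ_{l=j}^{k} e′_l Ã̃_l))]_{e′_l=0}"* — the terms whose minimal scale is `m`; and, with `Φ` the
`log Z` built on the quadratic form (5.7.11), **THE LEADING TERMS (5.7.12)**: *"The leading terms are now Σ_{n=1}^{n̄} (1/n!)
Σ_{{j_α}: min_α j_α = m} [Π_{α=1}^{n} ∂/∂e′_{j_α} log Z^{(j)}_{B_{m−j}(Λ₃^{(m)})}(Λ̄₂^{(m)}, u_{k+1} exp(ie_jζ Σ_{l=j}^{k} e′_l Ã̃_l))]_{e′_l=0},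
(5.7.12) where this Z^{(j)} uses the quadratic form in (5.7.11)"* (the same functional at another input function; likewise the
resummed p. 294 display with `log Z_m`). [cite: BalabanImbrieJaffe1988, (5.7.10) p.292, (5.7.12) p.293] -/
def leadGroup (Φ : (L → ℝ) → ℝ) (nbar : ℕ) (S : Finset L) (m : L) : ℝ :=
  ∑ n ∈ Finset.Icc 1 nbar, (1 / (n.factorial : ℝ)) *
    ∑ J ∈ (Fintype.piFinset (fun _ : Fin n => S)).filter (fun J => IsMinScale J m), mixedPartial Φ n J

/-- **(5.7.10) PROVED** — *"Note that Z^{(j)}_{Λ₁₀^{(j)}}(…) depends only on e_l for l ≥ j. Thus we can write the last expression as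
Σ_{m=j}^{k} Σ_{n=1}^{n̄} (1/n!) Σ_{{j_α}_{α=1}^{n} : min_α j_α = m} [Π_{α=1}^{n} ∂/∂e′_{j_α} log Z^{(j)}_{Λ₁₀^{(j)}}(u_{k+1} exp(ie_jζ Σ_{l=j}^{k}
e′_l Ã̃_l))]_{e′_l=0}. (5.7.10)"*: the low-order terms over the scales `S` equal the sum over `m ∈ S` of their `m`-th groups
(multilinear expansion of `(Σ_l ∂_l)ⁿ`, then regrouping of the tuples by their minimum). [cite: BalabanImbrieJaffe1988, (5.7.10) p.292] -/
theorem eq5710 (Φ : (L → ℝ) → ℝ) (nbar : ℕ) (S : Finset L) :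
    lowOrder Φ nbar S = ∑ m ∈ S, leadGroup Φ nbar S m := by
  unfold lowOrder leadGroup
  rw [Finset.sum_comm]
  refine Finset.sum_congr rfl fun n hn => ?_
  have hn1 : 0 < n := (Finset.mem_Icc.mp hn).1
  rw [dirPower_eq_sum_mixedPartial, sum_piFinset_eq_sum_isMinScale hn1, Finset.mul_sum]

/-- a scale outside `S` heads no group: `leadGroup Φ n̄ S m = 0` for `m ∉ S` (print: the groups are `m = j, …, k`).
[cite: BalabanImbrieJaffe1988, (5.7.10) p.292] -/
theorem leadGroup_eq_zero_of_not_mem (Φ : (L → ℝ) → ℝ) (nbar : ℕ) {S : Finset L} {m : L} (hm : m ∉ S) :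
    leadGroup Φ nbar S m = 0 := by
  unfold leadGroup
  refine Finset.sum_eq_zero fun n _ => ?_
  rw [Finset.sum_eq_zero fun J hJ => ?_, mul_zero]
  exfalso
  rw [Finset.mem_filter] at hJ
  obtain ⟨hJP, ⟨α, hα⟩, -⟩ := hJ
  exact hm (hα ▸ Fintype.mem_piFinset.mp hJP α)

/-! ## §4 The one-parameter reading: `(Σ_{l∈S} ∂_l)ⁿΦ(0) = dⁿ/dtⁿ Φ(t·𝟙_S)|_{t=0}` -/

omit [DecidableEq L] [LinearOrder L] in
/-- the `n`-th derivative along the line `t ↦ t·v` at `0` is the `n`-th Fréchet derivative at `0` on `(v,…,v)` (chain rule for a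
linear reparametrisation; `Φ` of class `Cⁿ`). [cite: BalabanImbrieJaffe1988, (5.6.14) p.288, (5.7.10) p.292] -/
theorem iteratedDeriv_comp_line {Φ : (L → ℝ) → ℝ} {n : ℕ} (hΦ : ContDiff ℝ n Φ) (v : L → ℝ) :
    iteratedDeriv n (fun t : ℝ => Φ (t • v)) 0 = iteratedFDeriv ℝ n Φ 0 (fun _ => v) := by
  have hfun : (fun t : ℝ => Φ (t • v)) = Φ ∘ (ContinuousLinearMap.toSpanSingleton ℝ v) := by
    funext t
    simp [ContinuousLinearMap.toSpanSingleton_apply]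
  rw [iteratedDeriv_eq_iteratedFDeriv, hfun, ContinuousLinearMap.iteratedFDeriv_comp_right _ hΦ 0 le_rfl,
    ContinuousMultilinearMap.compContinuousLinearMap_apply]
  simp [ContinuousLinearMap.toSpanSingleton_apply]

omit [LinearOrder L] in
/-- **the low-order terms as a one-parameter Taylor sum** — with `Ã̃ = Σ_{l∈S} Ã̃_l` switched on along `t ↦ t·𝟙_S`:
`lowOrder Φ n̄ S = Σ_{n=1}^{n̄} (1/n!) dⁿ/dtⁿ Φ(t·𝟙_S)|_{t=0}` for `Φ` of class `C^{n̄}` — the shape of the one-variable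
perturbative sums (5.6.14)/(5.7.15) of r16/p02 (`pertP`, `pertQ5715`). [cite: BalabanImbrieJaffe1988, (5.6.14) p.288, (5.7.10) p.292] -/
theorem lowOrder_eq_sum_iteratedDeriv {Φ : (L → ℝ) → ℝ} {nbar : ℕ} (hΦ : ContDiff ℝ nbar Φ) (S : Finset L) :
    lowOrder Φ nbar S = ∑ n ∈ Finset.Icc 1 nbar, (1 / (n.factorial : ℝ)) *
      iteratedDeriv n (fun t : ℝ => Φ (t • ∑ l ∈ S, (Pi.single l (1 : ℝ) : L → ℝ))) 0 := by
  unfold lowOrder dirPower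
  refine Finset.sum_congr rfl fun n hn => ?_
  have hle : (n : WithTop ℕ∞) ≤ nbar := by exact_mod_cast (Finset.mem_Icc.mp hn).2
  rw [iteratedDeriv_comp_line (hΦ.of_le hle)]

/-! ## §5 The top group `m = k`: the perturbation series in the top-scale field alone (the shape of (5.7.15)) -/

omit [Fintype L] [DecidableEq L] in
/-- in the TOP group every scale equals the top scale: for `k = max S`, a tuple from `Sⁿ` has minimal scale `k` iff it is the
constant tuple `(k,…,k)` (`n ≥ 1`). [cite: BalabanImbrieJaffe1988, (5.7.10) p.292, (5.7.15) p.295] -/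
theorem isMinScale_max_iff {n : ℕ} (hn : 0 < n) {S : Finset L} {k : L} (hmax : ∀ l ∈ S, l ≤ k)
    {J : Fin n → L} (hJ : J ∈ Fintype.piFinset (fun _ : Fin n => S)) :
    IsMinScale J k ↔ J = fun _ => k := by
  constructor
  · rintro ⟨-, hle⟩
    funext α
    exact le_antisymm (hmax _ (Fintype.mem_piFinset.mp hJ α)) (hle α)
  · rintro rfl
    exact ⟨⟨⟨0, hn⟩, rfl⟩, fun _ => le_rfl⟩

/-- **THE TOP GROUP IS THE ONE-SCALE SERIES**: for `k = max S` (`k ∈ S`), the `m = k` group of (5.7.10) keeps only the tuples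
`(k,…,k)`: `leadGroup Φ n̄ S k = Σ_{n=1}^{n̄} (1/n!) [∂ⁿ/∂e′_kⁿ Φ]_{e′=0}` — the *"standard perturbative expansion in the field"* of the
top scale alone, which (for the part of `Ã̃_k` in `θ_kH_{k,loc}A^{(k)}`, p. 295) is the shape of **(5.7.15)**
`Q^{(k)} = Σ_{n=1}^{n̄} dⁿ/de′ⁿ log[…]_{e′=0}` (r16's `pertP` / p02's `pertQ5715`, one parameter).
[cite: BalabanImbrieJaffe1988, (5.7.10) p.292, (5.7.15) p.295] -/
theorem leadGroup_max (Φ : (L → ℝ) → ℝ) (nbar : ℕ) {S : Finset L} {k : L} (hk : k ∈ S) (hmax : ∀ l ∈ S, l ≤ k) :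
    leadGroup Φ nbar S k = ∑ n ∈ Finset.Icc 1 nbar, (1 / (n.factorial : ℝ)) * mixedPartial Φ n (fun _ => k) := by
  unfold leadGroup
  refine Finset.sum_congr rfl fun n hn => ?_
  have hn1 : 0 < n := (Finset.mem_Icc.mp hn).1
  congr 1
  have hfilter : (Fintype.piFinset (fun _ : Fin n => S)).filter (fun J => IsMinScale J k) = {fun _ => k} := by
    ext J
    simp only [Finset.mem_filter, Finset.mem_singleton]
    constructor
    · rintro ⟨hJ, hmin⟩
      exact (isMinScale_max_iff hn1 hmax hJ).mp hmin
    · rintro rfl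
      have hmem : (fun _ : Fin n => k) ∈ Fintype.piFinset (fun _ : Fin n => S) := Fintype.mem_piFinset.mpr fun _ => hk
      exact ⟨hmem, (isMinScale_max_iff hn1 hmax hmem).mpr rfl⟩
  rw [hfilter, Finset.sum_singleton]

omit [LinearOrder L] in
/-- the pure `n`-th partial in one coordinate direction is the `n`-th derivative along that coordinate line (`Φ ∈ Cⁿ`).
[cite: BalabanImbrieJaffe1988, (5.7.15) p.295] -/
theorem mixedPartial_const_eq_iteratedDeriv {Φ : (L → ℝ) → ℝ} {n : ℕ} (hΦ : ContDiff ℝ n Φ) (k : L) :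
    mixedPartial Φ n (fun _ => k) = iteratedDeriv n (fun t : ℝ => Φ (t • (Pi.single k (1 : ℝ) : L → ℝ))) 0 := by
  rw [iteratedDeriv_comp_line hΦ]
  rfl

/-- **THE TOP GROUP AS THE ONE-PARAMETER TAYLOR SUM OF (5.7.15)**: for `Φ` of class `C^{n̄}` and `k = max S`,
`leadGroup Φ n̄ S k = Σ_{n=1}^{n̄} (1/n!) dⁿ/dtⁿ Φ(t·e_k)|_{t=0}`. [cite: BalabanImbrieJaffe1988, (5.7.10) p.292, (5.7.15) p.295] -/
theorem leadGroup_max_eq_sum_iteratedDeriv {Φ : (L → ℝ) → ℝ} {nbar : ℕ} (hΦ : ContDiff ℝ nbar Φ) {S : Finset L} {k : L}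
    (hk : k ∈ S) (hmax : ∀ l ∈ S, l ≤ k) :
    leadGroup Φ nbar S k = ∑ n ∈ Finset.Icc 1 nbar, (1 / (n.factorial : ℝ)) *
      iteratedDeriv n (fun t : ℝ => Φ (t • (Pi.single k (1 : ℝ) : L → ℝ))) 0 := by
  rw [leadGroup_max Φ nbar hk hmax]
  refine Finset.sum_congr rfl fun n hn => ?_
  have hle : (n : WithTop ℕ∞) ≤ nbar := by exact_mod_cast (Finset.mem_Icc.mp hn).2
  rw [mixedPartial_const_eq_iteratedDeriv (hΦ.of_le hle)]

end Literature.MathematicalPhysics.QuantumFieldTheory.BalabanImbrieJaffe1984to88.BIJ88Resummation5710
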